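import Summits.HodgeConjecture.HodgeConjecture.Theorems.F0P2oThetaJacquetTorusWeight   -- (5b) A-p16 (g24): the (D3d) weight, ker-level, `𝓢.omegaLoc v` currency (§2)
import Summits.HodgeConjecture.HodgeConjecture.Theorems.F0P2oN3OfTorusWeight          -- ★ p835661 THE N3 PACKAGER (+ ★ p835430 §1 `jacquetModule_twistedCoinv_comp_eq_smul`)
import HarnessLib

/-!
# Crux `H413`, programme P2, N3 road — THE `m(γ)`-WEIGHT ON `r_N(X_v)` ∀-CLOSED: the socket `hD` of the N3 packager
# ★ `F0P2oN3OfTorusWeight.thetaType_nonsplit_jacquetModule_of_a_of_torusWeight` DISCHARGED, and N3 modulo its clause (a) alone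

Cell hodgecm-mathlib (D-0151), FLOOR 0, crux item H413 = stmt-HodgeConjecture-24833, programme P2; N3 road of the K1 lead (B-p18 (g28) note v2
`F0/P2/B-p18/g28/N3-ROAD.v2.B-p18g28.md` §3; B-p18 (g29) dealing 2026-08-31T22:04:27Z «(b)-side: A-p16 (g24) wrapper → ★ p835430 sockets»).  Seat A-p16 (g24).
THEOREMS ONLY (no `def`, no instance, no notation, no named fact, no `sorry`); no `Cruxes/…/Lines` import; kernel lane `--supports stmt-HodgeConjecture-24833
--as helper`.  HC_CM is proved only modulo the printed citations (2 remaining named inputs hLiu418, h413) until rung 0 closes; nothing printed is asserted here.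

§1 `jacquetModule_xThetaGqsCM_torus_eq_smul_of_nonsplit`: at a NON-SPLIT finite place `v` of `L⁺`, for every torus element `t` of the Borel pair of `U(Φ₃)(L⁺_v)`
with middle entry `t₁₁ = 1` (so `t = d(γ, 1, γ̄⁻¹)`, `γ = t₀₀`, ★ `glDiagonal_torusEntry_eq_of_torusEntry_one_eq`), `t` acts on the Jacquet module `r_N(X_v)` of Liu's
local theta type `X_v = xThetaGqsCM L e₁ dV hdV hdV0 μ hμ χf ε v T ha h` by the scalar `μ_v(γ) · ‖γ‖^{1/2}` — print's (3.2.2) «`ω_ψ(d(α,1,ᾱ⁻¹)) Φ(w) =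
γ(α)‖α‖^{1/2} Φ(ᾱw)`» read on `r_N(ω³) ≅ ℱ` [GelbartRogawski1991, §3.2 p. 457] and descended to the `χ_{f,v}`-coinvariants (★ p835430 §1
`jacquetModule_twistedCoinv_comp_eq_smul`, `X_v = (ω_v)_{U(W), χ_{f,v}} ∘ localLineInl ∘ …` definitionally) from the ker-level weight ★ (5b)
`F0P2oThetaJacquetTorusWeight.omegaLoc_sub_smul_mem_coinvariantsKer_torus_of_nonsplit`.
§2 `forall_jacquetModule_xThetaGqsCM_torus_eq_smul`: the same ∀-CLOSED over the packager's binders — the TYPE of the socket `hD` of ★ p835661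
`thetaType_nonsplit_jacquetModule_of_a_of_torusWeight` (tree lines :80–:99) token for token.
§3 `thetaType_nonsplit_jacquetModule_of_a`: ★ `GelbartRogawski1991.thetaType_nonsplit_jacquetModule` (N3, the print letter verbatim) from its clause (a) ALONE
(`hA` = the packager's first socket, its text token for token) — `:= thetaType_nonsplit_jacquetModule_of_a_of_torusWeight hA §2`.

## References
* [GelbartRogawski1991] S. Gelbart, J. Rogawski, *L-functions and Fourier–Jacobi coefficients for the unitary group U(3)*, Invent. Math. 105 (1991):
  §3.2 (3.2.1)–(3.2.3) p. 457.
* [Kudla1986] S. Kudla, *On the local theta-correspondence*, Invent. Math. 83 (1986): Thm. 2.8.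
* [Rogawski1990] J. Rogawski, *Automorphic representations of unitary groups in three variables*, Ann. of Math. Stud. 123 (1990): §12.2 (2) p. 174.
-/

set_option autoImplicit false
-- the mandated namespace has the single-problem summit's repeated segment (`HodgeConjecture.HodgeConjecture`)
set_option linter.dupNamespace false

noncomputable section

open NumberField IsDedekindDomain MeasureTheory
open scoped Matrix
open Literature.NumberTheory Literature.NumberTheory.Automorphic Literature.NumberTheory.Automorphic.UnitaryGroup
open Literature.NumberTheory.Automorphic.IdeleClassGroup
open Literature.NumberTheory.Automorphic.Liu2021 Literature.NumberTheory.Automorphic.Liu2021.Def411WeilCarriers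
open Literature.NumberTheory.Automorphic.Liu2021.Def411WeilCarriersDoubling
open Literature.NumberTheory.GelbartRogawski1991.UnitaryDualPair Literature.NumberTheory.GelbartRogawski1991.UnitaryDualPair.WeilCoinv
open Literature.RepresentationTheory.Liu2021
open Literature.NumberTheory.GaloisRepresentations
open Literature.NumberTheory.Rogawski1990
open Literature.NumberTheory.GelbartRogawski1991
open Literature.RepresentationTheory
open Summit.HodgeConjecture.HodgeConjecture.Cruxes.H413.F0P2oN3TorusWeightOfD3d
open Summit.HodgeConjecture.HodgeConjecture.Cruxes.H413.F0P2oN3OfTorusWeight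
open Summit.HodgeConjecture.HodgeConjecture.Cruxes.H413.F0P2oThetaJacquetTorusWeight

namespace Summit.HodgeConjecture.HodgeConjecture.Cruxes.H413.F0P2oN3TorusWeightHolds

/-! ## §1 The `m(γ)`-weight on `r_N(X_v)` at a non-split place -/

set_option synthInstance.maxHeartbeats 400000 in
set_option maxHeartbeats 16000000 in
/-- **`d(γ, 1, γ̄⁻¹)` ACTS ON `r_N(X_v)` BY `μ_v(γ) · ‖γ‖^{1/2}`** at a non-split `v` (`t ∈ T(L⁺_v)` with `t₁₁ = 1`, `γ = t₀₀`; `X_v = xThetaGqsCM …`): the ker-level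
weight ★ (5b) `omegaLoc_sub_smul_mem_coinvariantsKer_torus_of_nonsplit` descended to the `χ_{f,v}`-coinvariants by ★ p835430 `jacquetModule_twistedCoinv_comp_eq_smul`
(its proof-term of `thetaType_nonsplit_jacquetModule_b_of_kerWeight`, verbatim). [cite: GelbartRogawski1991, §3.2 (3.2.2) p. 457] [cite: Kudla1986, Thm. 2.8] -/
theorem jacquetModule_xThetaGqsCM_torus_eq_smul_of_nonsplit (L : Type) [Field L] [NumberField L] [IsCMField L]
    {n' : ℕ} (e₁ : Fin 3 × Fin 1 ≃ Fin n') (dV : Fin 3 → L)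
    (hdV : ∀ i, IsCMField.complexConj L (dV i) = dV i) (hdV0 : ∀ i, dV i ≠ 0)
    (μ : Literature.NumberTheory.Automorphic.IdeleClassGroup L →ₜ* Circle) (hμ : IsConjugateSymplectic L μ)
    (χf : UnitaryGroup.finAdelicOne (↥(maximalRealSubfield L)) L (IsCMField.complexConj L) →* ℂˣ)
    (v : HeightOneSpectrum (𝓞 ↥(maximalRealSubfield L))) (hv : ∀ w : PlacesOver L v, IsCMField.complexConj L • w.1 = w.1)
    (ε : (↥(maximalRealSubfield L))ˣ)
    (T : GL (Fin 3) (UnitaryGroup.LocalRing L v)) {a : UnitaryGroup.LocalRing L v} (ha : IsUnit a)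
    (h : formCongr (conjLocal L (IsCMField.complexConj L) v) T ((Matrix.diagonal dV).map (algebraMap L (UnitaryGroup.LocalRing L v))) =
      a • (Matrix.of fun i j : Fin 3 => if i.val + j.val + 1 = 3 then (1 : L) else 0).map (algebraMap L (UnitaryGroup.LocalRing L v)))
    (t : ↥(cmBorelTriple L 3 v).M)
    (ht1 : torusEntry (conjLocal L (IsCMField.complexConj L) v) (cmLocalForm L 3 v) 1 t = 1)
    (x : ((cmBorelTriple L 3 v).restrict (xThetaGqsCM L e₁ dV hdV hdV0 μ hμ χf ε v T ha h)).Coinvariants) :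
    Representation.jacquetModule (xThetaGqsCM L e₁ dV hdV hdV0 μ hμ χf ε v T ha h) (cmBorelTriple L 3 v) t x =
      (((toHeckeCharacter L μ).semilocalComponent L v (torusEntry (conjLocal L (IsCMField.complexConj L) v) (cmLocalForm L 3 v) 0 t) *
          halfModulusChar (UnitaryGroup.LocalRing L v) (torusEntry (conjLocal L (IsCMField.complexConj L) v) (cmLocalForm L 3 v) 0 t) : ℂˣ) : ℂ) • x :=
  jacquetModule_twistedCoinv_comp_eq_smul
    (localCharOfCenter (↥(maximalRealSubfield L)) L (IsCMField.complexConj L) (JW (↥(maximalRealSubfield L)) L ε)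
      (JW_apply_ne_zero (↥(maximalRealSubfield L)) L ε) χf v)
    ((chiLocalSplittingsCM L e₁ dV hdV hdV0 (toHeckeCharacter L μ) ((isOscillatorChar_toHeckeCharacter_iff μ).mpr hμ) ε).omegaLoc v)
    (commute_omegaLoc_localCenter (↥(maximalRealSubfield L)) L (IsCMField.complexConj L) 3 e₁ (Matrix.diagonal dV)
      (JW (↥(maximalRealSubfield L)) L ε) (complexConj_imagUnit L) (imagUnit_ne_zero L) (imagUnit_mul_self L)
      (realDiagonal_isSymm L dV hdV) (isSymm_TW (↥(maximalRealSubfield L)) ε) (realDiagonal_map L dV hdV).symm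
      (JW_eq (↥(maximalRealSubfield L)) L ε) (JW_apply_ne_zero (↥(maximalRealSubfield L)) L ε)
      (chiLocalSplittingsCM L e₁ dV hdV hdV0 (toHeckeCharacter L μ) ((isOscillatorChar_toHeckeCharacter_iff μ).mpr hμ) ε) v)
    ((localLineInl L (IsCMField.complexConj L) 3 e₁ (Matrix.diagonal dV) (JW (↥(maximalRealSubfield L)) L ε) v).comp
      ((localPiEquiv L (IsCMField.complexConj L) 3 (Matrix.diagonal dV) v).symm.toMonoidHom.comp (cmDatumLocalCongr L v T ha h).toMonoidHom))
    (cmBorelTriple L 3 v) t _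
    (omegaLoc_sub_smul_mem_coinvariantsKer_torus_of_nonsplit L e₁ dV hdV hdV0 μ hμ v hv ε T ha h t ht1) x

/-! ## §2 The socket `hD` of ★ `thetaType_nonsplit_jacquetModule_of_a_of_torusWeight`, ∀-closed token for token -/

set_option synthInstance.maxHeartbeats 400000 in
set_option maxHeartbeats 16000000 in
/-- **THE `m(γ)`-WEIGHT ∀-CLOSED** — the type of the socket `hD` of ★ p835661 `F0P2oN3OfTorusWeight.thetaType_nonsplit_jacquetModule_of_a_of_torusWeight` (tree
lines :80–:99) token for token; `:= §1` (the two `χf`-hypotheses of the letter's binder are not needed). [cite: GelbartRogawski1991, §3.2 (3.2.2) p. 457]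
[cite: Kudla1986, Thm. 2.8] -/
theorem forall_jacquetModule_xThetaGqsCM_torus_eq_smul :
    ∀ (L : Type) [Field L] [NumberField L] [IsCMField L]
      {n' : ℕ} (e₁ : Fin 3 × Fin 1 ≃ Fin n') (dV : Fin 3 → L) (hdV : ∀ i, IsCMField.complexConj L (dV i) = dV i) (hdV0 : ∀ i, dV i ≠ 0)
      (μ : Literature.NumberTheory.Automorphic.IdeleClassGroup L →ₜ* Circle) (hμ : IsConjugateSymplectic L μ)
      (χf : UnitaryGroup.finAdelicOne (↥(maximalRealSubfield L)) L (IsCMField.complexConj L) →* ℂˣ),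
      Continuous χf → (∀ z, ‖((χf z : ℂˣ) : ℂ)‖ = 1) →
      ∀ (v : HeightOneSpectrum (𝓞 ↥(maximalRealSubfield L))),
        (∀ w : PlacesOver L v, IsCMField.complexConj L • w.1 = w.1) →
        ∀ (ε : (↥(maximalRealSubfield L))ˣ)
          (T : GL (Fin 3) (UnitaryGroup.LocalRing L v)) (a : UnitaryGroup.LocalRing L v) (ha : IsUnit a)
          (h : formCongr (conjLocal L (IsCMField.complexConj L) v) T ((Matrix.diagonal dV).map (algebraMap L (UnitaryGroup.LocalRing L v))) =
            a • (Matrix.of fun i j : Fin 3 => if i.val + j.val + 1 = 3 then (1 : L) else 0).map (algebraMap L (UnitaryGroup.LocalRing L v)))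
          (t : ↥(cmBorelTriple L 3 v).M),
          torusEntry (conjLocal L (IsCMField.complexConj L) v) (cmLocalForm L 3 v) 1 t = 1 →
          ∀ x : ((cmBorelTriple L 3 v).restrict (xThetaGqsCM L e₁ dV hdV hdV0 μ hμ χf ε v T ha h)).Coinvariants,
            Representation.jacquetModule (xThetaGqsCM L e₁ dV hdV hdV0 μ hμ χf ε v T ha h) (cmBorelTriple L 3 v) t x =
              (((toHeckeCharacter L μ).semilocalComponent L v (torusEntry (conjLocal L (IsCMField.complexConj L) v) (cmLocalForm L 3 v) 0 t) *
                  halfModulusChar (UnitaryGroup.LocalRing L v) (torusEntry (conjLocal L (IsCMField.complexConj L) v) (cmLocalForm L 3 v) 0 t) : ℂˣ) : ℂ) • x := by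
  intro L _ _ _ n' e₁ dV hdV hdV0 μ hμ χf _ _ v hv ε T a ha h t ht x
  exact jacquetModule_xThetaGqsCM_torus_eq_smul_of_nonsplit L e₁ dV hdV hdV0 μ hμ χf v hv ε T ha h t ht x

/-! ## §3 N3 — ★ `GelbartRogawski1991.thetaType_nonsplit_jacquetModule` — from its clause (a) alone -/

set_option synthInstance.maxHeartbeats 400000 in
set_option maxHeartbeats 16000000 in
/-- **N3 MODULO ITS CLAUSE (a)**: ★ `GelbartRogawski1991.thetaType_nonsplit_jacquetModule` (the print letter, verbatim) from `hA` = clause (a) («`r_N(X_v) ≃ ℱ_v[ψθ]`»,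
∀-closed; the text of the packager's first socket token for token) — the packager ★ p835661 with its `m(γ)`-socket `hD` discharged by §2.
[cite: GelbartRogawski1991, §3.2 (3.2.1)–(3.2.3) p. 457] [cite: Kudla1986, Thm. 2.8] [cite: Rogawski1990, §12.2 (2) p. 174] -/
theorem thetaType_nonsplit_jacquetModule_of_a
    (hA : ∀ (L : Type) [Field L] [NumberField L] [IsCMField L]
      {n' : ℕ} (e₁ : Fin 3 × Fin 1 ≃ Fin n') (dV : Fin 3 → L) (hdV : ∀ i, IsCMField.complexConj L (dV i) = dV i) (hdV0 : ∀ i, dV i ≠ 0)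
      {n₀ : ℕ} (e₀ : Fin 1 × Fin 1 ≃ Fin n₀)
      (μ : Literature.NumberTheory.Automorphic.IdeleClassGroup L →ₜ* Circle) (hμ : IsConjugateSymplectic L μ)
      (χf : UnitaryGroup.finAdelicOne (↥(maximalRealSubfield L)) L (IsCMField.complexConj L) →* ℂˣ),
      Continuous χf → (∀ z, ‖((χf z : ℂˣ) : ℂ)‖ = 1) →
      ∀ (v : HeightOneSpectrum (𝓞 ↥(maximalRealSubfield L))),
        (∀ w : PlacesOver L v, IsCMField.complexConj L • w.1 = w.1) →
        ∀ (ε : (↥(maximalRealSubfield L))ˣ) (ψθ : ↥(normOneUnits (conjLocal L (IsCMField.complexConj L) v)) →* ℂˣ),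
          IsThetaCenterChar L μ χf ε v ψθ →
          ∀ (T : GL (Fin 3) (UnitaryGroup.LocalRing L v)) (a : UnitaryGroup.LocalRing L v) (ha : IsUnit a)
            (h : formCongr (conjLocal L (IsCMField.complexConj L) v) T ((Matrix.diagonal dV).map (algebraMap L (UnitaryGroup.LocalRing L v))) =
              a • (Matrix.of fun i j : Fin 3 => if i.val + j.val + 1 = 3 then (1 : L) else 0).map (algebraMap L (UnitaryGroup.LocalRing L v))),
            Nonempty (((cmBorelTriple L 3 v).restrict (xThetaGqsCM L e₁ dV hdV hdV0 μ hμ χf ε v T ha h)).Coinvariants ≃ₗ[ℂ]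
              ↥(weightSpace (lineWeilCM L e₀ (kernelLineCM dV) (complexConj_kernelLineCM dV hdV) (kernelLineCM_ne_zero dV hdV0) μ hμ ε v) id
                (fun u => ((ψθ (localDet (IsCMField.complexConj L) v
                  (isUnit_iff_ne_zero.mpr (by rw [Matrix.det_fin_one]; exact JW_apply_ne_zero (↥(maximalRealSubfield L)) L ε))
                  (localPiEquiv L (IsCMField.complexConj L) 1 (JW (↥(maximalRealSubfield L)) L ε) v u)) : ℂˣ) : ℂ))))) :
    Literature.NumberTheory.GelbartRogawski1991.thetaType_nonsplit_jacquetModule :=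
  thetaType_nonsplit_jacquetModule_of_a_of_torusWeight hA forall_jacquetModule_xThetaGqsCM_torus_eq_smul

end Summit.HodgeConjecture.HodgeConjecture.Cruxes.H413.F0P2oN3TorusWeightHolds

end
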